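import Summits.QuantumFields.YangMills.Theorems.UnitScaleTiltProp7LineAvgTwoBlock
import HarnessLib

/-!
# Route `UnitScaleTilt`, crux K1 child «MinimiserStabilityRegPr» (stmt-QuantumFields-19200), registered stub `stub_prop7From14` (leaf V3 «Prop 7 from a
# background (14)») — THE SECOND-ORDER TAYLOR REMAINDER OF THE STRAIGHT-LINE BLOCK AVERAGE IN `ℓ²`-ALONG-CONTOURS FORM (flat main term):
# `‖L^{−kd}Σ_{x∈B^k(y)}(Π_{t<L^k}(1 + Y(x+te_μ)) − 1) − L^k·(Q_kY)(c)‖ ≤ L^{−k(d−1)}·Σ_{x∈B^k(y)}Σ_{t<L^k}‖Y(x+te_μ)‖²`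

Cell `ym3-torus` ∕ fleet seat `ym-ust-19200-p1` (gen 4).  WHERE THIS SITS.  In the `ℓ²` route to the uniqueness clause of [Balaban1985Variational] Prop. 7
at the d = 3 carrier (p504929), a secant `Y = WU⁻¹ − 1` between two points of one averaging fibre satisfies the constraint to second order: the linearised
average `(M_UY)(c)` equals minus the Taylor remainder of the averaging map.  Two steps of the route consume `Σ_c‖M_UY(c)‖` and `L^{k(d−2)}Σ_c‖M_UY(c)‖²`
(the multiplier pairing `⟨μ, M_UY⟩` of `UnitScaleTiltProp7LineAvgAdjoint` and the averaging penalty of the off-kernel coercivity forms p483802 ∕ p505901), and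
both are affordable ONLY with the remainder in `ℓ²`-ALONG-CONTOURS form — `O(L^k)·Σ_{contour}‖Y‖²` per contour, by Cauchy–Schwarz on `(Σ_{contour}‖Y‖)²` —
not with the sup form `(ℓδ)²` of the one-step linearisation (`BlockAveragingEMLLinearised`, p482040), which loses a volume factor `L^{kd}` against `Σ‖Y‖²`.
This file proves the `ℓ²`-along-contours remainder bound for the FLAT STRAIGHT-LINE MAIN TERM (products `Π_{t<L^k}(1 + Y(x + te_μ))` in an arbitrary normed
ring, no projection to the group, no comb legs): the model statement of the located brick D1c (iii) of the seat's CARD-19200-V3-g4.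

WHAT IS PROVED HERE (sorry-free, no definition; [folklore]).
* §1 ordered-product estimates in a normed ring: `norm_prod_ofFn_sub_one_le` (`‖Π(1+f_i) − 1‖ ≤ Π(1+‖f_i‖) − 1`),
  `norm_prod_ofFn_sub_one_sub_sum_le` (`‖Π(1+f_i) − 1 − Σf_i‖ ≤ Π(1+‖f_i‖) − 1 − Σ‖f_i‖`), `prod_one_add_sub_one_sub_sum_le_sq`
  (`Π(1+a_i) − 1 − Σa_i ≤ (Σa_i)²` for `a_i ≥ 0`, `Σa_i ≤ 1`), **`norm_prod_ofFn_sub_one_sub_sum_le_mul_sum_sq`** (`‖Π(1+f_i) − 1 − Σf_i‖ ≤ n·Σ‖f_i‖²` when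
  `Σ‖f_i‖ ≤ 1`).
* §2 **`norm_blockSum_lineProd_sub_le`**: for `‖Y‖ ≤ δ` with `L^k·δ ≤ 1`, `‖Σ_{x∈B^k(c₋)}(Π_{t<L^k}(1 + Y(x+te_μ)) − 1 − Σ_{t<L^k}Y(x+te_μ))‖ ≤
  L^k·Σ_{x∈B^k(c₋)}Σ_{t<L^k}‖Y(x+te_μ)‖²`; **`norm_avg_lineProd_sub_smul_bondAvgIter_le`**: the displayed inequality of the title with `Q_k = bondAvgIter k`
  (`Prop7FlatCoercivity.bondAvgIter_eq_lineBlockAvg`); `…_T3` at the d = 3 carrier for `M₂(ℂ)`-valued fields.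

WHAT THIS IS NOT.  Not the (0.4) average of record (`BlockAveraging.avgFun`: `exp`-mean-`log` of comb-decorated contours at a background) — its one-step
linearisation with SUP remainder is `BlockAveragingEMLLinearised(Background)` (p482040/p484812); the `ℓ²`-along-contours remainder for it, k-fold and at a
small-field background, is open (CARD-19200-V3-g4 §Open, D1c (iii)).  Nothing of Bałaban's is asserted.

References: T. Bałaban, CMP 102 (1985) 277–309 [Balaban1985Variational] ((44) p.285, (152) p.300); CMP 98 (1985) 17–51 [Balaban1985Averaging] (Prop. 3 (122)–(125) p.36).
-/

noncomputable section

open scoped BigOperators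

namespace Summit.QuantumFields.YangMills.Theorems.Prop7LineAvgTaylor

open Literature.MathematicalPhysics.QuantumFieldTheory.Balaban1983to89
open Finset LatticeFieldCalculus B1RG242Torus
open Summit.QuantumFields.YangMills.Theorems.Prop7FlatCoercivity (iterate_shift_eq_runSite runSite_runSite sum_fibre_eq_sum_offsets)

/-! ## §1 Ordered products close to one -/

section Products

variable {𝔸 : Type*} [NormedRing 𝔸]

/-- **FIRST PRODUCT ESTIMATE**: `‖Π_i(1 + f_i) − 1‖ ≤ Π_i(1 + ‖f_i‖) − 1` (ordered product). [folklore] -/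
theorem norm_prod_ofFn_sub_one_le : ∀ (n : ℕ) (f : Fin n → 𝔸),
    ‖(List.ofFn fun i => 1 + f i).prod - 1‖ ≤ (∏ i, (1 + ‖f i‖)) - 1
  | 0, f => by simp
  | n + 1, f => by
    rw [List.ofFn_succ, List.prod_cons, Fin.prod_univ_succ]
    have ih := norm_prod_ofFn_sub_one_le n (fun i => f i.succ)
    set Pr := (List.ofFn fun i : Fin n => 1 + f i.succ).prod with hPr
    have hP0 : 0 ≤ (∏ i : Fin n, (1 + ‖f i.succ‖)) - 1 := (norm_nonneg _).trans ih
    have key : (1 + f 0) * Pr - 1 = (Pr - 1) + f 0 * (Pr - 1) + f 0 := by noncomm_ring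
    rw [key]
    calc ‖(Pr - 1) + f 0 * (Pr - 1) + f 0‖ ≤ ‖Pr - 1‖ + ‖f 0‖ * ‖Pr - 1‖ + ‖f 0‖ :=
          (norm_add_le _ _).trans (add_le_add ((norm_add_le _ _).trans (add_le_add le_rfl (norm_mul_le _ _))) le_rfl)
      _ ≤ ((∏ i : Fin n, (1 + ‖f i.succ‖)) - 1) + ‖f 0‖ * ((∏ i : Fin n, (1 + ‖f i.succ‖)) - 1) + ‖f 0‖ := by gcongr
      _ = (1 + ‖f 0‖) * ∏ i : Fin n, (1 + ‖f i.succ‖) - 1 := by ring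

/-- **SECOND PRODUCT ESTIMATE**: `‖Π_i(1 + f_i) − 1 − Σ_i f_i‖ ≤ Π_i(1 + ‖f_i‖) − 1 − Σ_i‖f_i‖`. [folklore] -/
theorem norm_prod_ofFn_sub_one_sub_sum_le : ∀ (n : ℕ) (f : Fin n → 𝔸),
    ‖(List.ofFn fun i => 1 + f i).prod - 1 - ∑ i, f i‖ ≤ (∏ i, (1 + ‖f i‖)) - 1 - ∑ i, ‖f i‖
  | 0, f => by simp
  | n + 1, f => by
    rw [List.ofFn_succ, List.prod_cons, Fin.prod_univ_succ, Fin.sum_univ_succ, Fin.sum_univ_succ]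
    have ih := norm_prod_ofFn_sub_one_sub_sum_le n (fun i => f i.succ)
    have ih1 := norm_prod_ofFn_sub_one_le n (fun i => f i.succ)
    set Pr := (List.ofFn fun i : Fin n => 1 + f i.succ).prod with hPr
    have key : (1 + f 0) * Pr - 1 - (f 0 + ∑ i : Fin n, f i.succ) = (Pr - 1 - ∑ i : Fin n, f i.succ) + f 0 * (Pr - 1) := by noncomm_ring
    rw [key]
    calc ‖(Pr - 1 - ∑ i : Fin n, f i.succ) + f 0 * (Pr - 1)‖ ≤ ‖Pr - 1 - ∑ i : Fin n, f i.succ‖ + ‖f 0‖ * ‖Pr - 1‖ :=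
          (norm_add_le _ _).trans (add_le_add le_rfl (norm_mul_le _ _))
      _ ≤ ((∏ i : Fin n, (1 + ‖f i.succ‖)) - 1 - ∑ i : Fin n, ‖f i.succ‖) + ‖f 0‖ * ((∏ i : Fin n, (1 + ‖f i.succ‖)) - 1) :=
          add_le_add ih (mul_le_mul_of_nonneg_left ih1 (norm_nonneg _))
      _ = (1 + ‖f 0‖) * ∏ i : Fin n, (1 + ‖f i.succ‖) - 1 - (‖f 0‖ + ∑ i : Fin n, ‖f i.succ‖) := by ring

/-- `Π_i(1 + a_i) − 1 − Σ_i a_i ≤ (Σ_i a_i)²` for `a_i ≥ 0` with `Σ_i a_i ≤ 1` (`Π(1+a_i) ≤ e^{Σa_i}` and `e^s − 1 − s ≤ s²` on `[0,1]`). [folklore] -/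
theorem prod_one_add_sub_one_sub_sum_le_sq {n : ℕ} (a : Fin n → ℝ) (ha : ∀ i, 0 ≤ a i) (hs : ∑ i, a i ≤ 1) :
    (∏ i, (1 + a i)) - 1 - ∑ i, a i ≤ (∑ i, a i) ^ 2 := by
  have hs0 : 0 ≤ ∑ i, a i := Finset.sum_nonneg fun i _ => ha i
  have h1 : ∏ i, (1 + a i) ≤ Real.exp (∑ i, a i) := by
    rw [Real.exp_sum]
    exact Finset.prod_le_prod (fun i _ => by linarith [ha i]) (fun i _ => by linarith [Real.add_one_le_exp (a i)])
  have h2 : |Real.exp (∑ i, a i) - 1 - ∑ i, a i| ≤ (∑ i, a i) ^ 2 :=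
    Real.abs_exp_sub_one_sub_id_le (by rw [abs_of_nonneg hs0]; exact hs)
  linarith [le_abs_self (Real.exp (∑ i, a i) - 1 - ∑ i, a i)]

/-- **`‖Π_i(1 + f_i) − 1 − Σ_i f_i‖ ≤ n·Σ_i‖f_i‖²`** when `Σ_i‖f_i‖ ≤ 1` (second product estimate, `e^s − 1 − s ≤ s²`, Cauchy–Schwarz). [folklore] -/
theorem norm_prod_ofFn_sub_one_sub_sum_le_mul_sum_sq {n : ℕ} (f : Fin n → 𝔸) (hs : ∑ i, ‖f i‖ ≤ 1) :
    ‖(List.ofFn fun i => 1 + f i).prod - 1 - ∑ i, f i‖ ≤ (n : ℝ) * ∑ i, ‖f i‖ ^ 2 := by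
  have h1 := norm_prod_ofFn_sub_one_sub_sum_le n f
  have h2 := prod_one_add_sub_one_sub_sum_le_sq (fun i => ‖f i‖) (fun i => norm_nonneg _) hs
  have h3 : (∑ i, ‖f i‖) ^ 2 ≤ (n : ℝ) * ∑ i, ‖f i‖ ^ 2 := by
    have := Finset.sum_mul_sq_le_sq_mul_sq (univ : Finset (Fin n)) (fun _ => (1 : ℝ)) (fun i => ‖f i‖)
    simp only [one_mul, one_pow, Finset.sum_const, Finset.card_univ, Fintype.card_fin, nsmul_eq_mul, mul_one] at this
    exact this
  linarith

end Products

/-! ## §2 The straight-line block average: second-order remainder in `ℓ²`-along-contours form -/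

section Block

variable {P : Params} {k : ℕ} {𝔸 : Type*} [NormedRing 𝔸]

/-- **BLOCK SUM OF CONTOUR PRODUCTS, SECOND-ORDER REMAINDER**: for `‖Y‖ ≤ δ` with `L^k·δ ≤ 1`,
`‖Σ_{x∈B^k(c₋)}(Π_{t<L^k}(1 + Y(x+te_μ)) − 1 − Σ_{t<L^k}Y(x+te_μ))‖ ≤ L^k·Σ_{x∈B^k(c₋)}Σ_{t<L^k}‖Y(x+te_μ)‖²`.
[cite: Balaban1985Averaging, Prop. 3 (122)-(125) p.36] -/
theorem norm_blockSum_lineProd_sub_le {δ : ℝ} (Y : PBond P 0 → 𝔸) (hY : ∀ b : PBond P 0, ‖Y b‖ ≤ δ) (hδ : (P.L : ℝ) ^ k * δ ≤ 1) (c : PBond P k) :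
    ‖∑ x ∈ univ.filter (fun x : Site P 0 => Site.proj k k x = c.src),
        ((List.ofFn fun t : Fin (P.L ^ k) => 1 + Y ⟨runSite x c.dir t, c.dir⟩).prod - 1 - ∑ t : Fin (P.L ^ k), Y ⟨runSite x c.dir t, c.dir⟩)‖
      ≤ (P.L : ℝ) ^ k * ∑ x ∈ univ.filter (fun x : Site P 0 => Site.proj k k x = c.src), ∑ t : Fin (P.L ^ k), ‖Y ⟨runSite x c.dir t, c.dir⟩‖ ^ 2 := by
  have hline : ∀ x : Site P 0, ‖(List.ofFn fun t : Fin (P.L ^ k) => 1 + Y ⟨runSite x c.dir t, c.dir⟩).prod - 1 - ∑ t : Fin (P.L ^ k), Y ⟨runSite x c.dir t, c.dir⟩‖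
      ≤ (P.L : ℝ) ^ k * ∑ t : Fin (P.L ^ k), ‖Y ⟨runSite x c.dir t, c.dir⟩‖ ^ 2 := by
    intro x
    have hs : ∑ t : Fin (P.L ^ k), ‖Y ⟨runSite x c.dir t, c.dir⟩‖ ≤ 1 := by
      calc ∑ t : Fin (P.L ^ k), ‖Y ⟨runSite x c.dir t, c.dir⟩‖ ≤ ∑ _t : Fin (P.L ^ k), δ := Finset.sum_le_sum fun t _ => hY _
        _ = (P.L : ℝ) ^ k * δ := by rw [Finset.sum_const, Finset.card_univ, Fintype.card_fin, nsmul_eq_mul]; push_cast; ring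
        _ ≤ 1 := hδ
    have := norm_prod_ofFn_sub_one_sub_sum_le_mul_sum_sq (fun t : Fin (P.L ^ k) => Y ⟨runSite x c.dir t, c.dir⟩) hs
    push_cast at this
    exact this
  refine (norm_sum_le _ _).trans ?_
  rw [Finset.mul_sum]
  exact Finset.sum_le_sum fun x _ => hline x

/-- **THE STRAIGHT-LINE BLOCK AVERAGE TO SECOND ORDER IN `ℓ²`-ALONG-CONTOURS FORM**: for `‖Y‖ ≤ δ` with `L^k·δ ≤ 1`, `k` in the standing range,
`‖L^{−kd}Σ_{x∈B^k(c₋)}(Π_{t<L^k}(1 + Y(x+te_μ)) − 1) − L^k·(Q_kY)(c)‖ ≤ L^{−k(d−1)}·Σ_{x∈B^k(c₋)}Σ_{t<L^k}‖Y(x+te_μ)‖²`, `Q_k = bondAvgIter k`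
(`(Q_kY)(c) = L^{−k(d+1)}Σ_xΣ_t Y(x+te_μ)`, `Prop7FlatCoercivity.bondAvgIter_eq_lineBlockAvg`): on an averaging fibre (`block average of the products =
that of the background`) the linearised average is quadratically small in the `ℓ²` mass of `Y` on the block pair, with the factor `L^{−k(d−1)}`.
[cite: Balaban1985Averaging, Prop. 3 (122)-(125) p.36] -/
theorem norm_avg_lineProd_sub_smul_bondAvgIter_le [NormedAlgebra ℝ 𝔸] (hk : k ≤ P.m + P.K) {δ : ℝ} (Y : VecField P 0 𝔸)
    (hY : ∀ b : PBond P 0, ‖Y b‖ ≤ δ) (hδ : (P.L : ℝ) ^ k * δ ≤ 1) (c : PBond P k) :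
    ‖(((P.L : ℝ) ^ k) ^ P.d)⁻¹ • ∑ x ∈ univ.filter (fun x : Site P 0 => Site.proj k k x = c.src),
          ((List.ofFn fun t : Fin (P.L ^ k) => 1 + Y ⟨runSite x c.dir t, c.dir⟩).prod - 1)
        - ((P.L : ℝ) ^ k) • bondAvgIter k Y c‖
      ≤ (((P.L : ℝ) ^ k) ^ (P.d - 1))⁻¹ *
        ∑ x ∈ univ.filter (fun x : Site P 0 => Site.proj k k x = c.src), ∑ t : Fin (P.L ^ k), ‖Y ⟨runSite x c.dir t, c.dir⟩‖ ^ 2 := by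
  have hN : (0 : ℝ) < (P.L : ℝ) ^ k := pow_pos (by exact_mod_cast P.L_pos) k
  have hd : 1 ≤ P.d := P.hd
  -- `L^k • Q_kY(c) = L^{-kd} • Σ_x Σ_t Y`
  have hQ : ((P.L : ℝ) ^ k) • bondAvgIter k Y c = (((P.L : ℝ) ^ k) ^ P.d)⁻¹ •
      ∑ x ∈ univ.filter (fun x : Site P 0 => Site.proj k k x = c.src), ∑ t : Fin (P.L ^ k), Y ⟨runSite x c.dir t, c.dir⟩ := by
    rw [Prop7FlatCoercivity.bondAvgIter_eq_lineBlockAvg hk Y c, smul_smul]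
    simp only [iterate_shift_eq_runSite, Finset.sum_range]
    congr 1
    field_simp
  rw [hQ, ← smul_sub, ← Finset.sum_sub_distrib, norm_smul, norm_inv, norm_pow, norm_pow, Real.norm_natCast]
  have hB := norm_blockSum_lineProd_sub_le Y hY hδ c
  have hpow : (((P.L : ℝ) ^ k) ^ P.d)⁻¹ * ((P.L : ℝ) ^ k) = (((P.L : ℝ) ^ k) ^ (P.d - 1))⁻¹ := by
    have : ((P.L : ℝ) ^ k) ^ P.d = ((P.L : ℝ) ^ k) ^ (P.d - 1) * (P.L : ℝ) ^ k := by rw [← pow_succ]; congr 1; omega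
    rw [this]; field_simp
  calc (((P.L : ℝ) ^ k) ^ P.d)⁻¹ * ‖∑ x ∈ univ.filter (fun x : Site P 0 => Site.proj k k x = c.src),
          (((List.ofFn fun t : Fin (P.L ^ k) => 1 + Y ⟨runSite x c.dir t, c.dir⟩).prod - 1) - ∑ t : Fin (P.L ^ k), Y ⟨runSite x c.dir t, c.dir⟩)‖
      ≤ (((P.L : ℝ) ^ k) ^ P.d)⁻¹ * ((P.L : ℝ) ^ k *
          ∑ x ∈ univ.filter (fun x : Site P 0 => Site.proj k k x = c.src), ∑ t : Fin (P.L ^ k), ‖Y ⟨runSite x c.dir t, c.dir⟩‖ ^ 2) :=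
        mul_le_mul_of_nonneg_left hB (by positivity)
    _ = _ := by rw [← mul_assoc, hpow]

end Block

/-! ## §3 At the d = 3 carrier -/

open scoped Matrix.Norms.L2Operator in
/-- **AT THE d = 3 CARRIER** of `T3Thm1Carrier.varProblem3 F n K` (`k = K − n`, `M₂(ℂ)`-valued fluctuation fields in the `L²`-operator norm): for
`‖Y‖ ≤ δ` with `L^{K−n}δ ≤ 1`, `‖L^{−3(K−n)}Σ_{x∈B(c₋)}(Π_t(1 + Y(x+te_μ)) − 1) − L^{K−n}(Q_{K−n}Y)(c)‖ ≤ L^{−2(K−n)}·Σ_{x∈B(c₋)}Σ_t‖Y(x+te_μ)‖²`.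
[cite: Balaban1985Averaging, Prop. 3 (122)-(125) p.36] -/
theorem norm_avg_lineProd_sub_smul_bondAvgIter_le_T3 (F : T3ContinuumYM3Torus.T3Family) (n K : ℕ) {δ : ℝ}
    (Y : VecField (F.P K) 0 (Matrix (Fin 2) (Fin 2) ℂ)) (hY : ∀ b : PBond (F.P K) 0, ‖Y b‖ ≤ δ) (hδ : (F.L : ℝ) ^ (K - n) * δ ≤ 1)
    (c : PBond (F.P K) (K - n)) :
    ‖(((F.L : ℝ) ^ (K - n)) ^ 3)⁻¹ • ∑ x ∈ univ.filter (fun x : Site (F.P K) 0 => Site.proj (K - n) (K - n) x = c.src),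
          ((List.ofFn fun t : Fin (F.L ^ (K - n)) => 1 + Y ⟨runSite x c.dir t, c.dir⟩).prod - 1)
        - ((F.L : ℝ) ^ (K - n)) • bondAvgIter (K - n) Y c‖
      ≤ (((F.L : ℝ) ^ (K - n)) ^ 2)⁻¹ *
        ∑ x ∈ univ.filter (fun x : Site (F.P K) 0 => Site.proj (K - n) (K - n) x = c.src), ∑ t : Fin (F.L ^ (K - n)), ‖Y ⟨runSite x c.dir t, c.dir⟩‖ ^ 2 := by
  have h := norm_avg_lineProd_sub_smul_bondAvgIter_le (P := F.P K) (k := K - n) (show K - n ≤ F.m + K by omega) Y hY hδ c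
  have hd : (F.P K).d = 3 := rfl
  rw [hd] at h
  exact h

end Summit.QuantumFields.YangMills.Theorems.Prop7LineAvgTaylor

end
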